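import Literature.Analysis.FluidPDE.PassiveScalarDiagForced
import Literature.Analysis.FluidPDE.UniversalTotalAnomalousDissipator
import Literature.Analysis.FluidPDE.TurbWave0
import HarnessLib

/-!
# The scalar zeroth law in the long-time frame over a prescribed `κ`-independent carrier — objects

Definitions file (D-0016 `Theorems/<RouteSlug>Defs`) for the kinematic rung
`ScalarZerothLawKinematic` of cell `ad-ideate` (planner ad-ideate-p1, ROUND-10 §B and the typed
sketch `HOME/ad-ideate-p1/r10/ScalarZerothLaw.lean`, rc 0): the PASSIVE-SCALAR shadow of the summit
statement `Literature.Turb.ZerothLaw` — bounded long-time-mean scalar energy AND a positive floor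
for the long-time-mean scalar dissipation, uniformly in the diffusivity `κ ∈ (0, κ₀]` and in ALL
mean-zero `L²` data, for ONE prescribed, `κ`-independent, `C^α` stirring field with a steady smooth
source. Three `Prop`-valued objects, VERBATIM from the planner's sketch except that the definition
request D1 there (`IsWeakScalarTransportDiagForced`) has meanwhile LANDED as the tree's
`Literature.Analysis.FluidPDE.Torus.IsWeakScalarTransportDiagForced` (`PassiveScalarDiagForced.lean`)
and is used by its tree name:

* `IsStirringCarrier α L b` — a prescribed stirring field on `T²`: space–time measurable, bounded,
  `α`-Hölder in space uniformly in time, weakly divergence free at every time, `L`-periodic;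
* `ScalarZerothLawLongTime` — the qualitative law (one carrier per `α`; every smooth mean-zero
  steady source `S ≢ 0`; `E`, `ε > 0`, `κ₀ > 0` uniform in `κ ≤ κ₀` and in the datum);
* `ScalarZerothLawQuant` — the explicit charge–discharge form (period `L ≥ 12`, carrier silent on
  the quiet part `[nL + 1, (n+1)L]` of every period; (E∞) `‖θ(t)‖ ≤ ‖θ₀‖ + 3L‖S‖` a.e.,
  (E) `⟨‖θ‖²⟩⁺ ≤ 9L²‖S‖²`, (D) `⟨κ‖∇θ‖²⟩₋ ≥ (L/2 - 5)‖S‖²`).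

The companion proof files `ScalarZerothLawKinematic*.lean` prove
`HessChildsRowan2025a_cor13 → ScalarZerothLawQuant` (the planner's `Target`) and
`ScalarZerothLawQuant → ScalarZerothLawLongTime`. This is the prescribed-carrier (kinematic) rung next
to the TwoAndHalfD crux `ScalarAnomalySteadySourceFormal` (stmt-AnomalousDissipation-0448), whose
carriers are NS-generated; nothing here is a statement about Navier–Stokes. Supports
stmt-AnomalousDissipation-0448.
-/

noncomputable section

-- `Summit.<Summit>.<Problem>` is the tree's mandated summit-side namespace (CONVENTIONS §2); for this
-- single-conjunct summit the two coincide, so the duplicate is deliberate.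
set_option linter.dupNamespace false

namespace Summit.AnomalousDissipation.AnomalousDissipation.Theorems.ScalarZerothLawKinematic

open MeasureTheory Set Filter
open scoped NNReal ENNReal InnerProductSpace
open Literature.Analysis Literature.Analysis.FluidPDE

/-- A prescribed, `κ`-independent stirring carrier on `T²`: space–time measurable (through the
space–time lift), bounded by `A`, `α`-Hölder in space with constant `A` at every time, weakly
divergence free at every time, `L`-periodic in time. (The class of the periodised Hess-Childs–Rowan
fields; ad-ideate-p1 ROUND-10 §B1, verbatim.) -/
def IsStirringCarrier (α : ℝ≥0) (L : ℝ)
    (b : ℝ → UnitAddTorus (Fin 2) → EuclideanSpace ℝ (Fin 2)) : Prop :=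
  AEStronglyMeasurable (FunctionSpaces.Torus.stLift b) volume ∧
  (∃ A : ℝ≥0, (∀ (t : ℝ) (x : UnitAddTorus (Fin 2)), ‖b t x‖ ≤ A) ∧ ∀ t : ℝ, HolderWith A α (b t)) ∧
  (∀ t : ℝ, FunctionSpaces.Torus.IsWeaklyDivFree (b t)) ∧
  (∀ t : ℝ, b (t + L) = b t)

/-- **Scalar zeroth law in the long-time frame (qualitative).** For every `α ∈ (0,1)` there are a
period `L > 0` and ONE stirring carrier `b` (independent of `κ`, of the source and of the datum)
such that for EVERY smooth mean-zero steady source `S ≢ 0` there are `E`, `ε > 0`, `κ₀ > 0` with: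
for all `κ ∈ (0, κ₀]`, all mean-zero `θ₀ ∈ L²(T²)` and every global weak solution `θ` of
`∂ₜθ + b·∇θ = κ(½∂₀∂₀ + ∂₁∂₁)θ + S`, `θ(0) = θ₀`
(`Torus.IsWeakScalarTransportDiagForced ![2⁻¹, 1] κ b (fun _ => S) θ₀ θ`),
(E) `limsup_T T⁻¹∫₀ᵀ ‖θ(t)‖²_{L²} dt ≤ E` and (D) `liminf_T T⁻¹∫₀ᵀ κ‖∇θ(t)‖²_{L²} dt ≥ ε`
(`longTimeAvgSup` / `longTimeAvgInf` of `TurbWave0`, spectral `Torus.eScalarGradNormSq`, `.toReal` —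
the convention of `Turb.meanDissipation`). `E`, `ε` do not depend on `κ` or `θ₀` (compare
`Literature.Turb.ZerothLaw`: there `∃E`/`∃ε` over a family `u_j` with chosen data; here the bound is
uniform over ALL data). (ad-ideate-p1 ROUND-10 §B1, verbatim.) -/
def ScalarZerothLawLongTime : Prop :=
  ∀ α : ℝ≥0, 0 < α → α < 1 →
    ∃ (L : ℝ) (b : ℝ → UnitAddTorus (Fin 2) → EuclideanSpace ℝ (Fin 2)), 0 < L ∧ IsStirringCarrier α L b ∧
      ∀ S : UnitAddTorus (Fin 2) → ℝ, FunctionSpaces.Torus.IsSmooth S → FunctionSpaces.Torus.HasZeroMean S →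
        (∃ x, S x ≠ 0) →
        ∃ (E ε κ₀ : ℝ), 0 < ε ∧ 0 < κ₀ ∧
          ∀ κ : ℝ, 0 < κ → κ ≤ κ₀ →
            ∀ θ₀ : UnitAddTorus (Fin 2) → ℝ, MemLp θ₀ 2 volume → ∫ x, θ₀ x = 0 →
              ∀ θ : ℝ → UnitAddTorus (Fin 2) → ℝ,
                Torus.IsWeakScalarTransportDiagForced ![2⁻¹, 1] κ b (fun _ => S) θ₀ θ →
                  longTimeAvgSup (fun t => Torus.scalarL2Sq (θ t)) ≤ E ∧
                  ε ≤ longTimeAvgInf (fun t => κ * (Torus.eScalarGradNormSq (θ t)).toReal)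

/-- **Scalar zeroth law, explicit charge–discharge form** (what ROUND-10 §B3 proves from
`HessChildsRowan2025a_cor13`): for every `α ∈ (0,1)` and every period `L ≥ 12` there is a stirring
carrier `b` of period `L`, vanishing on the "quiet" part `[nL + 1, (n+1)L]` of every period, such
that for every smooth mean-zero source `S` there is `κ₀ = κ₀(α, L, S) > 0` with: for all
`κ ∈ (0,κ₀]`, all mean-zero `L²` data and every global weak solution,
(E∞) `‖θ(t)‖²_{L²} ≤ (‖θ₀‖_{L²} + 3L‖S‖_{L²})²` for a.e. `t ∈ (0,T)`, every `T > 0` (kills the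
`limsup` junk value), (E) `⟨‖θ‖²⟩⁺ ≤ 9 L² ‖S‖²_{L²}`, and (D) `⟨κ‖∇θ‖²⟩₋ ≥ (L/2 - 5) ‖S‖²_{L²}`.
So `ε ≥ c · ‖S‖ · ⟨‖θ‖²⟩^{1/2}` with an absolute `c` — saturation of the injection bound
`χ = ⟨(S,θ)⟩ ≤ ‖S‖⟨‖θ‖²⟩^{1/2}` uniformly in `κ`, the scalar analogue of `ε ~ U³/ℓ`.
(ad-ideate-p1 ROUND-10 §B1, verbatim.) -/
def ScalarZerothLawQuant : Prop :=
  ∀ α : ℝ≥0, 0 < α → α < 1 → ∀ L : ℝ, 12 ≤ L →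
    ∃ b : ℝ → UnitAddTorus (Fin 2) → EuclideanSpace ℝ (Fin 2), IsStirringCarrier α L b ∧
      (∀ (n : ℤ) (t : ℝ), (n : ℝ) * L + 1 ≤ t → t ≤ ((n : ℝ) + 1) * L → b t = 0) ∧
      ∀ S : UnitAddTorus (Fin 2) → ℝ, FunctionSpaces.Torus.IsSmooth S → FunctionSpaces.Torus.HasZeroMean S →
        ∃ κ₀ : ℝ, 0 < κ₀ ∧
          ∀ κ : ℝ, 0 < κ → κ ≤ κ₀ →
            ∀ θ₀ : UnitAddTorus (Fin 2) → ℝ, MemLp θ₀ 2 volume → ∫ x, θ₀ x = 0 →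
              ∀ θ : ℝ → UnitAddTorus (Fin 2) → ℝ,
                Torus.IsWeakScalarTransportDiagForced ![2⁻¹, 1] κ b (fun _ => S) θ₀ θ →
                  (∀ T : ℝ, 0 < T → ∀ᵐ t ∂(volume.restrict (Ioo 0 T)),
                      Torus.scalarL2Sq (θ t) ≤
                        (Real.sqrt (Torus.scalarL2Sq θ₀) + 3 * L * Real.sqrt (Torus.scalarL2Sq S)) ^ 2) ∧
                  longTimeAvgSup (fun t => Torus.scalarL2Sq (θ t)) ≤ 9 * L ^ 2 * Torus.scalarL2Sq S ∧
                  (L / 2 - 5) * Torus.scalarL2Sq S ≤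
                    longTimeAvgInf (fun t => κ * (Torus.eScalarGradNormSq (θ t)).toReal)

end Summit.AnomalousDissipation.AnomalousDissipation.Theorems.ScalarZerothLawKinematic

end
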